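import Summits.NavierStokesRegularity.NavierStokesRegularity.Theses.KelvinCirculationBudget
import Literature.Analysis.FluidPDE.NSSuitableESSRefutation
import Literature.Analysis.FluidPDE.NSQuasipotential

/-!
# `CircBudget` is false without its energy-class hypotheses (self-stretching linear vortex)

Negative-side support for the crux `KelvinCirculationBudget.CircBudget`
(stmt-NavierStokesRegularity-18358, route `KelvinCirculationBudget`, rank 2), refuter crux-attack seat
(2026-08-17). LOAD-BEARING ANALYSIS: the crux with its two energy-class hypotheses —
`IsLerayHopfOn T ν 0 (u 0) u` and `HasRapidSpatialDecay (u 0)` — DROPPED (keeping only "classical solution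
of unforced Navier–Stokes on `[0,T)`") is FALSE (`circBudget_false_without_energyClass`; the weakened
statement is written INLINE, it is not a Theses decl). Witness: the exact self-similarly accelerated linear
flow `u(t, x) = (T − t)⁻¹ M x`, `p(t, x) = −½ (T − t)⁻² ⟪x, (M + M²) x⟫` with
`M = [[-½, -½, 0], [½, -½, 0], [0, 0, 1]]` (axial strain `diag(-½, -½, 1)` plus the rotation `½ e₂ × x`):
`Ṁ-coefficient (T−t)⁻² M + (T−t)⁻² M² = (T−t)⁻² diag(-½, -½, 2)` is symmetric, so it is a pressure
Hessian; `tr M = 0`, `ΔMx = 0`. Its vorticity is the spatially constant vector `(T − t)⁻¹ e₂` (vortex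
stretching `ẇ = s w` driven by the strain `s = (T − t)⁻¹`), so the signed charge of the unit ball is
`|B₁| (T − t)⁻¹ e₂`, unbounded as `t ↑ T`: no `K` with `‖∫_{B_r(x)} curl u(t)‖ ≤ K r` for all `t < T`,
`r ≤ 1` exists (`T = 1`, `x = 0`, `r = 1`, `t = 1 − min 1 (|B₁| / (2(|K|+1)))`).

CONSEQUENCES for provers: (i) the local Kelvin/vorticity-transport structure alone (charge changes only
through boundary fluxes) does NOT bound the charge — this flow satisfies it exactly while `|Q|/r → ∞`; any
proof of the crux must use finite energy / decay to starve the persistent strain; (ii) the conclusion's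
functional is not trivially bounded on classical solutions, so the crux is not vacuous-by-kinematics.
Also recorded: the hypotheses of the crux are satisfiable (rest state) and its conclusion holds there
(`circBudget_hypotheses_satisfiable`), so the crux is consistent and non-vacuous at the trivial model.
-/

noncomputable section

namespace Summit.NavierStokesRegularity.NavierStokesRegularity.Theorems.CircBudget.Negative

open MeasureTheory Set Function Filter Metric Literature.Analysis.FluidPDE
open scoped Laplacian ContDiff ENNReal InnerProductSpace RealInnerProductSpace Topology

section General

variable {E : Type*} [NormedAddCommGroup E] [InnerProductSpace ℝ E] [FiniteDimensional ℝ E]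

/-- **Self-similarly accelerated linear flows are classical Navier–Stokes solutions.** Let `L`, `N` be
linear maps of a finite-dimensional inner product space with `L + L² = N`, `N` symmetric and `tr L = 0`.
Then `u(t, x) = (T − t)⁻¹ L x`, `p(t, x) = −½ (T − t)⁻² ⟪x, N x⟫` is a classical solution of the unforced
Navier–Stokes system on `[0, T)` for every viscosity: `∂ₜu = (T−t)⁻² L x`, `(u·∇)u = (T−t)⁻² L² x`,
`Δu = 0`, `∇p = −(T−t)⁻² N x`, `div u = (T−t)⁻¹ tr L = 0` (Majda–Bertozzi 2002, §1.2: exact solutions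
linear in `x`, `u = A(t) x` with `Ȧ + A²` symmetric). [folklore] -/
theorem isClassicalNSSolutionOn_inv_smul_clm (T : ℝ) (L N : E →L[ℝ] E)
    (hN : ∀ x, L x + L (L x) = N x) (hNsymm : ∀ x y, ⟪N x, y⟫ = ⟪x, N y⟫)
    (htr : LinearMap.trace ℝ E (L : E →ₗ[ℝ] E) = 0) (ν : ℝ) :
    IsClassicalNSSolutionOn (Ico 0 T) ν 0 (fun t x => (T - t)⁻¹ • L x)
      (fun t x => -((T - t)⁻¹ ^ 2 / 2 * ⟪x, N x⟫)) where
  smooth_velocity := by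
    change ContDiffOn ℝ ∞ (fun q : ℝ × E => (T - q.1)⁻¹ • L q.2) (Ico 0 T ×ˢ univ)
    have h1 : ContDiffOn ℝ ∞ (fun q : ℝ × E => (T - q.1)⁻¹) (Ico 0 T ×ˢ univ) := by
      refine ContDiffOn.inv (contDiff_const.sub contDiff_fst).contDiffOn ?_
      rintro ⟨t, x⟩ ⟨ht, -⟩
      exact (sub_pos.mpr ht.2).ne'
    exact h1.smul (L.contDiff.comp contDiff_snd).contDiffOn
  smooth_pressure := by
    change ContDiffOn ℝ ∞ (fun q : ℝ × E => -((T - q.1)⁻¹ ^ 2 / 2 * ⟪q.2, N q.2⟫)) (Ico 0 T ×ˢ univ)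
    have h1 : ContDiffOn ℝ ∞ (fun q : ℝ × E => (T - q.1)⁻¹) (Ico 0 T ×ˢ univ) := by
      refine ContDiffOn.inv (contDiff_const.sub contDiff_fst).contDiffOn ?_
      rintro ⟨t, x⟩ ⟨ht, -⟩
      exact (sub_pos.mpr ht.2).ne'
    have h2 : ContDiff ℝ ∞ (fun q : ℝ × E => ⟪q.2, N q.2⟫) :=
      contDiff_snd.inner ℝ (N.contDiff.comp contDiff_snd)
    exact (((h1.pow 2).div_const 2).mul h2.contDiffOn).neg
  momentum t ht x := by
    have hTt : 0 < T - t := sub_pos.mpr ht.2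
    -- time derivative within `[0, T)`
    have hd : HasDerivAt (fun s : ℝ => (T - s)⁻¹) ((T - t)⁻¹ ^ 2) t := by
      have h : HasDerivAt (fun s : ℝ => (T - s)⁻¹) (-(-1) / (T - t) ^ 2) t :=
        ((hasDerivAt_id t).const_sub T).inv (by simpa using hTt.ne')
      refine h.congr_deriv ?_
      rw [neg_neg, one_div, inv_pow]
    have hderiv : derivWithin (fun s => (T - s)⁻¹ • L x) (Ico 0 T) t = ((T - t)⁻¹ ^ 2) • L x :=
      ((hd.smul_const (L x)).hasDerivWithinAt).derivWithin (uniqueDiffOn_Ico 0 T t ht)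
    have hfun : (fun x => (T - t)⁻¹ • L x) = ⇑((T - t)⁻¹ • L) := rfl
    -- pressure gradient
    have hg : HasGradientAt (fun x : E => -((T - t)⁻¹ ^ 2 / 2 * ⟪x, N x⟫))
        (-((T - t)⁻¹ ^ 2) • N x) x := by
      have h1 : HasFDerivAt (fun x : E => ⟪x, N x⟫)
          ((fderivInnerCLM ℝ ((x, N x) : E × E)).comp ((ContinuousLinearMap.id ℝ E).prod N)) x :=
        (hasFDerivAt_id x).inner ℝ N.hasFDerivAt
      have h2 := (h1.const_mul ((T - t)⁻¹ ^ 2 / 2)).neg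
      rw [hasGradientAt_iff_hasFDerivAt]
      refine h2.congr_fderiv ?_
      ext h
      simp only [InnerProductSpace.toDual_apply_apply, neg_apply, smul_apply,
        ContinuousLinearMap.coe_comp, Function.comp_apply, ContinuousLinearMap.prod_apply,
        ContinuousLinearMap.coe_id', id_eq, fderivInnerCLM_apply, smul_eq_mul]
      rw [real_inner_smul_left, real_inner_comm (N x) h, hNsymm x h]
      ring
    show timeDerivWithin (Ico 0 T) (fun t x => (T - t)⁻¹ • L x) t x +
        convect (fun x => (T - t)⁻¹ • L x) (fun x => (T - t)⁻¹ • L x) x =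
      ν • (Δ (fun x => (T - t)⁻¹ • L x)) x -
        gradient (fun x : E => -((T - t)⁻¹ ^ 2 / 2 * ⟪x, N x⟫)) x + (0 : ℝ → E → E) t x
    rw [timeDerivWithin_apply, hderiv, hfun, convect_clm_apply, laplacian_clm_apply, hg.gradient]
    simp only [smul_apply, map_smul, smul_smul, Pi.zero_apply, add_zero, smul_zero, zero_sub]
    rw [← hN x, smul_add, sq]
    simp only [neg_smul, neg_add, neg_neg]
  divFree t ht := by
    intro x
    have hfun : (fun x => (T - t)⁻¹ • L x) = ⇑((T - t)⁻¹ • L) := rfl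
    show VectorCalculus.divergence (fun x => (T - t)⁻¹ • L x) x = 0
    rw [hfun, divergence_clm_apply]
    simp [htr]

end General

/-- **The hypotheses of `CircBudget` are satisfiable and its conclusion holds at the witness** (rest
state `u ≡ 0`, `p ≡ 0`, any `ν, T > 0`; charge `0 ≤ 0 · r`): the crux is consistent and its hypothesis
class is inhabited (non-vacuity at the trivial model; genuine inhabitants are the strong solutions from
Schwartz data restricted to `[0, T)`, `T ≤ T*`). [folklore] -/
theorem circBudget_hypotheses_satisfiable :
    ∃ (ν T : ℝ) (u : ℝ → EuclideanSpace ℝ (Fin 3) → EuclideanSpace ℝ (Fin 3))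
      (p : ℝ → EuclideanSpace ℝ (Fin 3) → ℝ), 0 < ν ∧ 0 < T ∧
      IsClassicalNSSolutionOn (Set.Ico 0 T) ν 0 u p ∧ IsLerayHopfOn T ν 0 (u 0) u ∧
      HasRapidSpatialDecay (u 0) ∧
      ∃ K : ℝ, ∀ t ∈ Set.Ico 0 T, ∀ (x : EuclideanSpace ℝ (Fin 3)) (r : ℝ), 0 < r → r ≤ 1 →
        ‖∫ y in Metric.ball x r, curl (u t) y‖ ≤ K * r := by
  refine ⟨1, 1, 0, 0, one_pos, one_pos, isClassicalNSSolutionOn_zero _ _, isLerayHopfOn_zero _ _,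
    ?_, 0, ?_⟩
  · intro n K
    refine ⟨0, fun x => ?_⟩
    simp [Pi.zero_def]
  · intro t _ x r hr _
    have h0 : ∀ y, curl ((0 : ℝ → EuclideanSpace ℝ (Fin 3) → EuclideanSpace ℝ (Fin 3)) t) y = 0 :=
      fun y => by
        ext i
        simp only [curl, Pi.zero_apply, fderiv_zero, zero_apply, PiLp.zero_apply,
          sub_zero, PiLp.toLp_apply]
        fin_cases i <;> simp
    simp only [h0, integral_zero, norm_zero, zero_mul, le_refl]

/-- **`CircBudget` is false without its energy-class hypotheses.** The crux
`KelvinCirculationBudget.CircBudget` with `IsLerayHopfOn T ν 0 (u 0) u` and `HasRapidSpatialDecay (u 0)`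
dropped (statement inline) fails: along the self-stretching linear flow `u(t,x) = (1 − t)⁻¹ M x`
(classical on `[0,1)`, every `ν`) the vorticity is `(1 − t)⁻¹ e₂`, so the unit-ball charge at the
origin has norm `|B₁| (1 − t)⁻¹ → ∞` as `t ↑ 1`, defeating every `K`. Hence every proof of the crux
uses finite energy / decay. [folklore] -/
theorem circBudget_false_without_energyClass :
    ¬ (∀ (ν T : ℝ), 0 < ν → 0 < T →
        ∀ (u : ℝ → EuclideanSpace ℝ (Fin 3) → EuclideanSpace ℝ (Fin 3))
          (p : ℝ → EuclideanSpace ℝ (Fin 3) → ℝ),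
        IsClassicalNSSolutionOn (Set.Ico 0 T) ν 0 u p →
        ∃ K : ℝ, ∀ t ∈ Set.Ico 0 T, ∀ (x : EuclideanSpace ℝ (Fin 3)) (r : ℝ), 0 < r → r ≤ 1 →
          ‖∫ y in Metric.ball x r, curl (u t) y‖ ≤ K * r) := by
  intro h
  -- columns of `M` and of `N = M + M²`
  set c₀ : EuclideanSpace ℝ (Fin 3) := WithLp.toLp 2 ![-1/2, 1/2, 0] with hc₀
  set c₁ : EuclideanSpace ℝ (Fin 3) := WithLp.toLp 2 ![-1/2, -1/2, 0] with hc₁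
  set c₂ : EuclideanSpace ℝ (Fin 3) := WithLp.toLp 2 ![0, 0, 1] with hc₂
  set n₀ : EuclideanSpace ℝ (Fin 3) := WithLp.toLp 2 ![-1/2, 0, 0] with hn₀
  set n₁ : EuclideanSpace ℝ (Fin 3) := WithLp.toLp 2 ![0, -1/2, 0] with hn₁
  set n₂ : EuclideanSpace ℝ (Fin 3) := WithLp.toLp 2 ![0, 0, 2] with hn₂
  set L : EuclideanSpace ℝ (Fin 3) →L[ℝ] EuclideanSpace ℝ (Fin 3) :=
    (EuclideanSpace.proj (0 : Fin 3)).smulRight c₀ + (EuclideanSpace.proj (1 : Fin 3)).smulRight c₁ +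
      (EuclideanSpace.proj (2 : Fin 3)).smulRight c₂ with hL
  set N : EuclideanSpace ℝ (Fin 3) →L[ℝ] EuclideanSpace ℝ (Fin 3) :=
    (EuclideanSpace.proj (0 : Fin 3)).smulRight n₀ + (EuclideanSpace.proj (1 : Fin 3)).smulRight n₁ +
      (EuclideanSpace.proj (2 : Fin 3)).smulRight n₂ with hNdef
  have hLx : ∀ x, L x = x 0 • c₀ + x 1 • c₁ + x 2 • c₂ := fun x => rfl
  have hNx : ∀ x, N x = x 0 • n₀ + x 1 • n₁ + x 2 • n₂ := fun x => rfl
  have hLi : ∀ x (i : Fin 3), L x i = x 0 * c₀ i + x 1 * c₁ i + x 2 * c₂ i := fun x i => by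
    rw [hLx]; simp
  have hNi : ∀ x (i : Fin 3), N x i = x 0 * n₀ i + x 1 * n₁ i + x 2 * n₂ i := fun x i => by
    rw [hNx]; simp
  have hN : ∀ x, L x + L (L x) = N x := fun x => by
    ext i
    simp only [PiLp.add_apply, hNi, hLi]
    fin_cases i <;> simp [hc₀, hc₁, hc₂, hn₀, hn₁, hn₂] <;> ring
  have hNsymm : ∀ x y, ⟪N x, y⟫ = ⟪x, N y⟫ := fun x y => by
    simp only [PiLp.inner_apply, hNi, Fin.sum_univ_three, RCLike.inner_apply, conj_trivial]
    simp [hn₀, hn₁, hn₂]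
    ring
  have htr : LinearMap.trace ℝ (EuclideanSpace ℝ (Fin 3))
      (L : EuclideanSpace ℝ (Fin 3) →ₗ[ℝ] EuclideanSpace ℝ (Fin 3)) = 0 := by
    rw [LinearMap.trace_eq_sum_inner _ (EuclideanSpace.basisFun (Fin 3) ℝ)]
    simp only [Fin.sum_univ_three, EuclideanSpace.basisFun_apply, ContinuousLinearMap.coe_coe,
      EuclideanSpace.inner_single_left, hLi]
    simp [hc₀, hc₁, hc₂]
  -- the classical solution on `[0, 1)` with `ν = 1`
  have hsol := isClassicalNSSolutionOn_inv_smul_clm (1 : ℝ) L N hN hNsymm htr 1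
  obtain ⟨K, hK⟩ := h 1 1 one_pos one_pos _ _ hsol
  -- its vorticity is the constant vector `(1 - t)⁻¹ e₂`
  have hcurl : ∀ (t : ℝ) (y : EuclideanSpace ℝ (Fin 3)), curl (fun x => (1 - t)⁻¹ • L x) y =
      (1 - t)⁻¹ • EuclideanSpace.single (2 : Fin 3) (1 : ℝ) := fun t y => by
    have hfun : (fun x => (1 - t)⁻¹ • L x) = ⇑((1 - t)⁻¹ • L) := rfl
    rw [hfun]
    ext i
    simp only [curl, ContinuousLinearMap.fderiv, smul_apply, PiLp.smul_apply, smul_eq_mul, hLi]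
    fin_cases i <;> simp [hc₀, hc₁, hc₂]
    ring
  -- volume of the unit ball
  have hvol : volume.real (ball (0 : EuclideanSpace ℝ (Fin 3)) 1) = Real.pi * 4 / 3 := by
    rw [measureReal_def, EuclideanSpace.volume_ball_fin_three]
    simp [ENNReal.toReal_ofReal (by positivity : (0 : ℝ) ≤ Real.pi * 4 / 3)]
  set V : ℝ := Real.pi * 4 / 3 with hV
  have hVpos : 0 < V := by rw [hV]; positivity
  -- the charge of the unit ball at time `t`
  have hcharge : ∀ t : ℝ, t < 1 →
      ‖∫ y in ball (0 : EuclideanSpace ℝ (Fin 3)) 1, curl ((fun t x => (1 - t)⁻¹ • L x) t) y‖ =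
        V * (1 - t)⁻¹ := by
    intro t ht
    have h1t : 0 < 1 - t := sub_pos.mpr ht
    have he : ‖EuclideanSpace.single (2 : Fin 3) (1 : ℝ)‖ = 1 := by simp
    simp only [hcurl]
    rw [setIntegral_const, hvol, norm_smul, norm_smul, he, Real.norm_eq_abs, Real.norm_eq_abs,
      abs_of_pos hVpos, abs_of_pos (inv_pos.mpr h1t), mul_one]
  -- choose `t` close to `1`
  set m : ℝ := min 1 (V / (2 * (|K| + 1))) with hm
  have hKpos : 0 < 2 * (|K| + 1) := by positivity
  have hmpos : 0 < m := lt_min one_pos (div_pos hVpos hKpos)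
  have hm1 : m ≤ 1 := min_le_left _ _
  have ht : (1 - m) ∈ Ico (0 : ℝ) 1 := ⟨by linarith, by linarith⟩
  have hbound := hK (1 - m) ht 0 1 one_pos le_rfl
  rw [hcharge (1 - m) (by linarith), mul_one, show (1 - (1 - m)) = m by ring] at hbound
  -- `V / m ≥ 2(|K|+1) > K`
  have hge : 2 * (|K| + 1) ≤ V * m⁻¹ := by
    rw [← div_eq_mul_inv, le_div_iff₀ hmpos]
    have := min_le_right 1 (V / (2 * (|K| + 1)))
    rw [← hm] at this
    calc 2 * (|K| + 1) * m ≤ 2 * (|K| + 1) * (V / (2 * (|K| + 1))) := by gcongr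
      _ = V := by field_simp
  have hK' : K < 2 * (|K| + 1) := by
    have := le_abs_self K
    linarith
  linarith

end Summit.NavierStokesRegularity.NavierStokesRegularity.Theorems.CircBudget.Negative
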